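import Literature.AnabelianGeometry.SemiGraphs.ArithSemiGraphNonVacuity
import Literature.AnabelianGeometry.AbsoluteAnabelian.MLFSlimKummerProofs
import Literature.AnabelianGeometry.AbsoluteAnabelian.MLFGaloisTFGProofs
import HarnessLib

/-!
# [SemiAnbd] Def. 5.1 (ii): `ArithSemiGraph` with the GENUINE arithmetic component `π̂₁(A) = G_K`,
# `K/ℚ_p` finite (non-vacuity; upgrade of the `π̂₁(A) = 1` record)

Mochizuki, *Semi-graphs of anabelioids*, Publ. RIMS **42** (2006), §5, Definition 5.1 (i)/(ii), manuscript
p. 62 [cite: MochizukiSemiAnbd2006, Def 5.1 (ii), p. 62]; Example 5.6 p. 67 (the arithmetic component of the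
semi-graph of anabelioids of a pointed stable curve over an MLF `K` is `G_K`, resp. an open subgroup of it)
[cite: MochizukiSemiAnbd2006, Ex 5.6, p. 67].

PROOF-ONLY file (abc-iut cell, layer L3, NV lane; seat abc-iut-w6-d108, row «ArithSemiGraph-GQp»,
abc-iut-L3-lead (gen 5) α63; theorems only — no `def`, no `instance`, no new named fact).  Sequel of
abc-iut-w6-d117's `ArithSemiGraphNonVacuity.lean` (`ArithSemiGraph.exists_of_trivial_action` /
`ArithSemiGraph.exists_ofReal`: the record inhabited with the DEGENERATE arithmetic component `π̂₁(A) = 1`),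
whose honest label names the missing input for Def. 5.1's motivating arithmetic component `π̂₁(A) = G_K`:
Def 5.1 (i)(a) "`π̂₁(A)` topologically finitely generated" for `G_K` ([NSW] 7.5.10; GAP-LEDGER G-L4t4-2).
That input is in the tree BY NAME: abc-iut-L4-d1's
`isTopologicallyFinitelyGenerated_absoluteGaloisGroup_padic_of_localEPC` (`MLFGaloisTFGProofs.lean`, p419680),
conditional only on the tree's named fact `localEulerPoincareCharacteristic` (Tate's local Euler–Poincaré
characteristic), which is PROVED Summits-side (`localEulerPoincareCharacteristic_holds`; unconditional
`ℚ_p`-corollary `Summit.ABC.IUTFork.isTopologicallyFinitelyGenerated_absoluteGaloisGroup_padic`, p421667 —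
not importable from `Literature/`).  Slimness of `G_K` is the tree's THEOREM `galoisMLF_slim_holds`
(abc-iut-L4-d2, [AbsAnab] Thm 1.1.1 (ii), F-0027).  Contents:

* `SemiAnbdVocab.isContinuousAction_one_of_condA` — over ANY vocabulary: the trivial action `ρ := 1` of ANY
  profinite group satisfying (a) is continuous (d117's lemma assumed `PA` finite only to get (a) and the
  continuity in (c) for free; for `ρ = 1` the outer representations `H → Out(π̂₁(𝔾_v))` are CONSTANT).
* `ArithSemiGraph.exists_of_trivial_action_of_isSlimGroup` — hence any slim, topologically finitely generated
  profinite `PA` is the arithmetic component of an `ArithSemiGraph 𝓥` on any connected coherent locally finite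
  `G` with finitely many vertices (identity trivial on branches), with `ρ := 1`.
* AT THE REAL VOCABULARY `SemiAnbdVocab.ofReal R`: `ArithSemiGraph.exists_ofReal_absoluteGaloisGroup_of_tfg`
  (`π̂₁(A) := G_K` for any finite `K/ℚ_p`, hypothesis `IsTopologicallyFinitelyGenerated G_K` EXPLICIT — the
  form Summits-side consumers discharge with p421667) and `…_of_localEPC` (the same under the EPC fact BY
  NAME, exactly as L4-d1's theorem carries it); geometric component = d117's Example 2.10 one-vertex model.

HONEST LABEL.  The arithmetic component is now the genuine `G_K`, but the ACTION is still the trivial one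
(on a one-vertex edgeless `𝔾` every action is trivial on the underlying graph; the outer action on
`π̂₁(𝔾_v)` of a real degenerating curve is not trivial and is not modelled) — this is the shape
`StableReductionTower.arithEmb` asks for at a level, not the arithmetic semi-graph of anabelioids of a
pointed stable curve.  Instantiated ≠ endorsed; nothing of [SemiAnbd] is asserted; no side is taken on
[IUTchIII] Cor. 3.12.
-/

noncomputable section

namespace Literature.AnabelianGeometry.SemiGraphs

open _root_.CategoryTheory
open Literature.AlgebraicGeometry.Frobenioids (IsSlimGroup)
open Literature.AnabelianGeometry.AbsoluteAnabelian
open Literature.NumberTheory.GaloisRepresentations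

universe u v w

/-! ### Def 5.1 (i): the trivial action of a topologically finitely generated profinite group is continuous -/

section General

variable {Obj : Type u} [Category.{v} Obj] (𝓥 : SemiAnbdVocab.{u, v, w} Obj)

/-- **Def 5.1 (i) for the trivial action of an arbitrary profinite group satisfying (a).**  Let `G` be
locally finite ((b)) with finitely many vertices, the identity arrow acting trivially on branches, and let
`PA` be topologically finitely generated ((a)).  Then `ρ := 1` is continuous: witness `H := PA`; (c) `ρ(h) = id`
fixes every vertex and branch and the outer representation `H → Out(π̂₁(𝔾_v))` is the CONSTANT map; (d) all
vertices with the identity isomorphisms. [cite: MochizukiSemiAnbd2006, Def 5.1 (i), p. 62] -/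
theorem SemiAnbdVocab.isContinuousAction_one_of_condA (G : Obj) (hlf : 𝓥.IsLocallyFinite G)
    [Finite (𝓥.Vert G)] (hbr : ∀ x : (Σ e : 𝓥.Edge G, 𝓥.Br e), 𝓥.mapTotalBr (𝟙 G) x = x)
    (PA : ProfiniteGrp.{w}) (hA : Def51CondA PA) :
    IsContinuousAction 𝓥 G PA (1 : PA →* Aut G) := by
  classical
  have hhom : ∀ h : PA, ((1 : PA →* Aut G) h).hom = 𝟙 G := fun _ => rfl
  have hfixV : ∀ h ∈ (⊤ : OpenSubgroup PA), ∀ v : 𝓥.Vert G,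
      𝓥.mapV ((1 : PA →* Aut G) h).hom v = v := by
    intro h _ v
    rw [hhom, 𝓥.mapV_id]
  have h1 : ∀ v : 𝓥.Vert G, 𝓥.mapV (1 : Aut G).hom v = v := fun v => by
    rw [show (1 : Aut G).hom = 𝟙 G from rfl, 𝓥.mapV_id]
  have hC : Def51CondC 𝓥 G PA 1 ⊤ :=
    { fixesVert := hfixV
      fixesBr := fun h _ x => by rw [hhom]; exact hbr x
      continuous_outRep := fun v =>
        (continuous_const (y := 𝓥.outRep (1 : Aut G) v (h1 v))).congr fun _ => rfl }
  refine ⟨⊤, { condA := hA, condB := hlf, condC := hC, condD := ?_ }⟩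
  refine ⟨Set.univ, Set.finite_univ, fun w => ⟨w, Set.mem_univ _, Iso.refl _, fun h hh => ?_⟩⟩
  simp

/-- **`ArithSemiGraph 𝓥` with a prescribed slim, topologically finitely generated arithmetic component**
(Def 5.1 (ii)): every connected, coherent, locally finite object `G` with finitely many vertices (identity
trivial on branches) is the geometric component of a connected arithmetic semi-graph of anabelioids with
`π̂₁(A) := PA` and the trivial action, for ANY slim `PA` satisfying (a).
[cite: MochizukiSemiAnbd2006, Def 5.1 (ii), p. 62] -/
theorem ArithSemiGraph.exists_of_trivial_action_of_isSlimGroup (G : Obj) (hconn : 𝓥.IsConnected G)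
    (hcoh : 𝓥.IsCoherent G) (hlf : 𝓥.IsLocallyFinite G) [Finite (𝓥.Vert G)]
    (hbr : ∀ x : (Σ e : 𝓥.Edge G, 𝓥.Br e), 𝓥.mapTotalBr (𝟙 G) x = x)
    (PA : ProfiniteGrp.{w}) (hslim : IsSlimGroup PA) (hA : Def51CondA PA) :
    ∃ 𝔊 : ArithSemiGraph 𝓥, 𝔊.G = G ∧ 𝔊.PA = PA ∧ 𝔊.ρ = 1 :=
  ⟨{ G := G
     connected := hconn
     coherent := hcoh
     PA := PA
     slim := hslim
     ρ := 1
     continuous := 𝓥.isContinuousAction_one_of_condA G hlf hbr PA hA }, rfl, rfl, rfl⟩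

end General

/-! ### At the real vocabulary, arithmetic component `G_K` for `K/ℚ_p` finite -/

section Galois

open Field SgAQuot

/-- **`ArithSemiGraph` over `SemiAnbdVocab.ofReal R` with `π̂₁(A) := G_K`**, `K` a finite extension of
`ℚ_p`, GIVEN (a) "`G_K` topologically finitely generated" as an explicit hypothesis (dischargeable
Summits-side by `Summit.ABC.IUTFork.isTopologicallyFinitelyGenerated_absoluteGaloisGroup_padic`, p421667):
`G_K` is slim by the tree's theorem `galoisMLF_slim_holds` ([AbsAnab] Thm 1.1.1 (ii)); the geometric
component is abc-iut-w6-d117's one-vertex edgeless Example 2.10 model (`ArithSemiGraph.exists_ofReal`); the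
action is trivial. [cite: MochizukiSemiAnbd2006, Def 5.1 (ii), p. 62] -/
theorem ArithSemiGraph.exists_ofReal_absoluteGaloisGroup_of_tfg (R : SgA.BridgeResidual.{0, 1, 0})
    (p : ℕ) [Fact p.Prime] (K : Type) [Field K] [Algebra ℚ_[p] K] [FiniteDimensional ℚ_[p] K]
    [CharZero K] (hA : IsTopologicallyFinitelyGenerated (absoluteGaloisGroup K)) :
    ∃ 𝔊 : ArithSemiGraph (SemiAnbdVocab.ofReal R),
      𝔊.PA = ProfiniteGrp.of (absoluteGaloisGroup K) ∧ 𝔊.ρ = 1 ∧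
        Nonempty (Unique ((SemiAnbdVocab.ofReal R).Vert 𝔊.G)) ∧ IsEmpty ((SemiAnbdVocab.ofReal R).Edge 𝔊.G) := by
  obtain ⟨𝔊₀, -, -, ⟨hU⟩, hE⟩ := ArithSemiGraph.exists_ofReal R
  haveI := hU
  haveI := hE
  obtain ⟨𝔊, hG, hPA, hρ⟩ :=
    ArithSemiGraph.exists_of_trivial_action_of_isSlimGroup (SemiAnbdVocab.ofReal R) 𝔊₀.G 𝔊₀.connected
      𝔊₀.coherent ((SemiAnbdVocab.ofReal R).isLocallyFinite_of_isEmpty 𝔊₀.G) (fun x => isEmptyElim x.1)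
      (ProfiniteGrp.of (absoluteGaloisGroup K)) (galoisMLF_slim_holds p K) hA
  refine ⟨𝔊, hPA, hρ, ⟨?_⟩, ?_⟩
  · rw [hG]; exact hU
  · rw [hG]; exact hE

/-- **The same for `K = ℚ_p` itself** (`π̂₁(A) := G_{ℚ_p}`), given (a).
[cite: MochizukiSemiAnbd2006, Def 5.1 (ii), p. 62] -/
theorem ArithSemiGraph.exists_ofReal_GQp_of_tfg (R : SgA.BridgeResidual.{0, 1, 0}) (p : ℕ) [Fact p.Prime]
    (hA : IsTopologicallyFinitelyGenerated (absoluteGaloisGroup ℚ_[p])) :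
    ∃ 𝔊 : ArithSemiGraph (SemiAnbdVocab.ofReal R), 𝔊.PA = ProfiniteGrp.of (absoluteGaloisGroup ℚ_[p]) ∧ 𝔊.ρ = 1 := by
  obtain ⟨𝔊, h1, h2, -⟩ := ArithSemiGraph.exists_ofReal_absoluteGaloisGroup_of_tfg R p ℚ_[p] hA
  exact ⟨𝔊, h1, h2⟩

/-- **`ArithSemiGraph` with `π̂₁(A) := G_K`, modulo Tate's local Euler–Poincaré characteristic BY NAME**
(the tree's named fact `localEulerPoincareCharacteristic`, proved Summits-side; carried here exactly as in
abc-iut-L4-d1's `isTopologicallyFinitelyGenerated_absoluteGaloisGroup_padic_of_localEPC`, which supplies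
(a) from it). [cite: MochizukiSemiAnbd2006, Def 5.1 (ii), p. 62]
[cite: NeukirchSchmidtWingberg2008, Thm. 7.5.10] -/
theorem ArithSemiGraph.exists_ofReal_absoluteGaloisGroup_of_localEPC
    (hEP : ∀ (F : Type) [Field F] [ValuativeRel F] [TopologicalSpace F] [IsNonarchimedeanLocalField F]
      [CharZero F], localEulerPoincareCharacteristic F)
    (R : SgA.BridgeResidual.{0, 1, 0}) (p : ℕ) [Fact p.Prime] (K : Type) [Field K] [Algebra ℚ_[p] K]
    [FiniteDimensional ℚ_[p] K] [CharZero K] :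
    ∃ 𝔊 : ArithSemiGraph (SemiAnbdVocab.ofReal R),
      𝔊.PA = ProfiniteGrp.of (absoluteGaloisGroup K) ∧ 𝔊.ρ = 1 ∧
        Nonempty (Unique ((SemiAnbdVocab.ofReal R).Vert 𝔊.G)) ∧ IsEmpty ((SemiAnbdVocab.ofReal R).Edge 𝔊.G) :=
  ArithSemiGraph.exists_ofReal_absoluteGaloisGroup_of_tfg R p K
    (isTopologicallyFinitelyGenerated_absoluteGaloisGroup_padic_of_localEPC hEP p K)

/-- Census / by-name form: modulo the EPC fact, `ArithSemiGraph (SemiAnbdVocab.ofReal R)` has an inhabitant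
whose arithmetic fundamental group is `G_{ℚ_p}` — Def. 5.1's motivating (non-degenerate, slim, infinite)
arithmetic component. [cite: MochizukiSemiAnbd2006, Def 5.1 (ii), p. 62] -/
theorem ArithSemiGraph.exists_ofReal_GQp_of_localEPC
    (hEP : ∀ (F : Type) [Field F] [ValuativeRel F] [TopologicalSpace F] [IsNonarchimedeanLocalField F]
      [CharZero F], localEulerPoincareCharacteristic F)
    (R : SgA.BridgeResidual.{0, 1, 0}) (p : ℕ) [Fact p.Prime] :
    ∃ 𝔊 : ArithSemiGraph (SemiAnbdVocab.ofReal R), 𝔊.PA = ProfiniteGrp.of (absoluteGaloisGroup ℚ_[p]) ∧ 𝔊.ρ = 1 :=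
  ArithSemiGraph.exists_ofReal_GQp_of_tfg R p
    (isTopologicallyFinitelyGenerated_absoluteGaloisGroup_padic_of_localEPC hEP p ℚ_[p])

/-! ### Appended (same row α63): every OPEN subgroup of `G_K` as arithmetic component — the exact
shape of `StableReductionTower.arithEmb` (`π̂₁(A_i) ↪ G_K` continuous, injective, with open image) -/

/-- Open subgroups of slim groups are slim (import-light private copy of the tree's
`IsSlimGroup.subgroup_of_isOpen`, `AbsoluteAnabelian/AbsTopIChainsRemark422.lean`, which is not in this
file's import closure): an open subgroup of an open `H` is open in `G`, so its centraliser is trivial.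
[cite: MochizukiSemiAnbd2006, Ex 3.10 p.45] -/
private theorem isSlimGroup_subgroup_of_isOpen' {G : Type u} [Group G] [TopologicalSpace G]
    [ContinuousMul G] (hG : IsSlimGroup G) (H : Subgroup G) (hH : IsOpen (H : Set G)) : IsSlimGroup H := by
  refine ⟨fun U hU => ?_⟩
  have hUo : IsOpen ((U.map H.subtype : Subgroup G) : Set G) := by
    have : ((U.map H.subtype : Subgroup G) : Set G) = Subtype.val '' (U : Set H) := by
      ext x; simp
    rw [this]
    exact hH.isOpenMap_subtype_val _ hU
  have hc := hG.centralizer_eq_bot _ hUo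
  refine (Subgroup.eq_bot_iff_forall _).mpr fun c hc' => ?_
  have hcG : (c : G) ∈ Subgroup.centralizer ((U.map H.subtype : Subgroup G) : Set G) := by
    rw [Subgroup.mem_centralizer_iff]
    rintro _ ⟨u, hu, rfl⟩
    exact congrArg Subtype.val (Subgroup.mem_centralizer_iff.mp hc' u hu)
  rw [hc] at hcG
  exact Subtype.ext (Subgroup.mem_bot.mp hcG)

/-- **`ArithSemiGraph` with arithmetic component ANY OPEN SUBGROUP `U ≤ G_K`** (`K/ℚ_p` finite), given
(a) for `G_K`: `U` is compact (open ⇒ closed), slim (`isSlimGroup_subgroup_of_isOpen'` over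
`galoisMLF_slim_holds`) and topologically finitely generated (`IsTopologicallyFinitelyGenerated.subgroup_isOpen`,
Schreier); the arithmetic component `π̂₁(A) := U` comes WITH its continuous injective homomorphism into
`G_K` of range `U` — the three fields `continuous_arithEmb` / `injective_arithEmb` / `range_arithEmb` of
`StableReductionTower` at one level (Example 5.6: "`π̂₁(A_i) = M_i/N_i ⊆ G_K`").  Trivial action on the
one-vertex Example 2.10 model, honestly. [cite: MochizukiSemiAnbd2006, Ex 5.6, p. 67] -/
theorem ArithSemiGraph.exists_ofReal_openSubgroup_absoluteGaloisGroup_of_tfg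
    (R : SgA.BridgeResidual.{0, 1, 0}) (p : ℕ) [Fact p.Prime] (K : Type) [Field K] [Algebra ℚ_[p] K]
    [FiniteDimensional ℚ_[p] K] [CharZero K] (hA : IsTopologicallyFinitelyGenerated (absoluteGaloisGroup K))
    (U : Subgroup (absoluteGaloisGroup K)) (hU : IsOpen (U : Set (absoluteGaloisGroup K))) :
    ∃ (𝔊 : ArithSemiGraph (SemiAnbdVocab.ofReal R)) (e : 𝔊.PA →ₜ* absoluteGaloisGroup K),
      Function.Injective e ∧ e.toMonoidHom.range = U ∧ 𝔊.ρ = 1 ∧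
        Nonempty (Unique ((SemiAnbdVocab.ofReal R).Vert 𝔊.G)) ∧ IsEmpty ((SemiAnbdVocab.ofReal R).Edge 𝔊.G) := by
  haveI : CompactSpace U := isCompact_iff_compactSpace.mp (U.isClosed_of_isOpen hU).isCompact
  obtain ⟨𝔊₀, -, -, ⟨hV⟩, hE⟩ := ArithSemiGraph.exists_ofReal R
  haveI := hV
  haveI := hE
  exact
    ⟨{ G := 𝔊₀.G
       connected := 𝔊₀.connected
       coherent := 𝔊₀.coherent
       PA := ProfiniteGrp.of U
       slim := isSlimGroup_subgroup_of_isOpen' (galoisMLF_slim_holds p K) U hU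
       ρ := 1
       continuous := (SemiAnbdVocab.ofReal R).isContinuousAction_one_of_condA 𝔊₀.G
         ((SemiAnbdVocab.ofReal R).isLocallyFinite_of_isEmpty 𝔊₀.G) (fun x => isEmptyElim x.1)
         (ProfiniteGrp.of U) (hA.subgroup_isOpen U hU) },
      { toMonoidHom := U.subtype, continuous_toFun := continuous_subtype_val },
      Subtype.val_injective, U.range_subtype, rfl, ⟨hV⟩, hE⟩

/-- The same modulo Tate's local Euler–Poincaré characteristic BY NAME (L4-d1's carrying of (a)).
[cite: MochizukiSemiAnbd2006, Ex 5.6, p. 67] -/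
theorem ArithSemiGraph.exists_ofReal_openSubgroup_absoluteGaloisGroup_of_localEPC
    (hEP : ∀ (F : Type) [Field F] [ValuativeRel F] [TopologicalSpace F] [IsNonarchimedeanLocalField F]
      [CharZero F], localEulerPoincareCharacteristic F)
    (R : SgA.BridgeResidual.{0, 1, 0}) (p : ℕ) [Fact p.Prime] (K : Type) [Field K] [Algebra ℚ_[p] K]
    [FiniteDimensional ℚ_[p] K] [CharZero K]
    (U : Subgroup (absoluteGaloisGroup K)) (hU : IsOpen (U : Set (absoluteGaloisGroup K))) :
    ∃ (𝔊 : ArithSemiGraph (SemiAnbdVocab.ofReal R)) (e : 𝔊.PA →ₜ* absoluteGaloisGroup K),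
      Function.Injective e ∧ e.toMonoidHom.range = U ∧ 𝔊.ρ = 1 ∧
        Nonempty (Unique ((SemiAnbdVocab.ofReal R).Vert 𝔊.G)) ∧ IsEmpty ((SemiAnbdVocab.ofReal R).Edge 𝔊.G) :=
  ArithSemiGraph.exists_ofReal_openSubgroup_absoluteGaloisGroup_of_tfg R p K
    (isTopologicallyFinitelyGenerated_absoluteGaloisGroup_padic_of_localEPC hEP p K) U hU

end Galois

end Literature.AnabelianGeometry.SemiGraphs

end
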